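/- Width seat `ym-line-cbag-p1-w3` (prover-ym-line-cbag-p1-w3-g0-0), route `ColdBoxAllGroups`, crux `BoxFloorAllGroups`
(stmt-QuantumFields-22254), line `birth`, skeleton v4 / lead's PLAN v5: brick B4 «RepresentationG» of stub S2,
part 1 (Gaussian side and density identity). -/
import Summits.QuantumFields.YangMills.Theorems.ColdBoxAllGroupsOneScaleDefs
import Summits.QuantumFields.YangMills.Theorems.WeakCouplingRatesColdBoxGaussRef
import Mathlib.MeasureTheory.Measure.Haar.Unique

/-!
# Crux `BoxFloorAllGroups`, brick B4 «RepresentationG», part 1: the Gaussian side with `D` colours and the density identity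

`G`-generic port (lead's vocabulary `ColdBoxAllGroupsOneScaleDefs`: `TSpaceD`, `gaussD`, `qObsD`, `unscaleTE`, `scaleEquivE`, `cfgTE`,
`tiltWE`) of the Gaussian half of `WeakCouplingRatesColdBoxGaussRef` (the `SU(2)` brick R4 of the proved crux `ColdBoxTwoPointFloorW`,
three colours):
* `exists_lintegral_eq_mul_lintegral_unscaleTE` — the constant-Jacobian change of variables `w = unscaleTE H D β t` (the image of Lebesgue
  measure under the linear equivalence `scaleEquivE` is a Haar measure, hence a multiple of Lebesgue measure);
* `sum_formM_div_two_eq_sum_qObsD`, `prod_gaussWeight_eq_D` — `Π_i gaussWeight_{Q_D}(t i) = exp(−Σ_{p touching Λ} qObsD p t)`;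
* `lintegral_mul_prod_gaussWeight_eq_D` — `∫⁻ F·Π_i gaussWeight(t i) dt = Z^D·∫⁻ F d(gaussD H D)`;
* `boltzmann_mul_density_eq` — the density identity `e^{−βS_Λ(cfgTE t)}·Π_e g(a_e) = Π_i gaussWeight(t i)·e^{tiltWE ρ H g β t}` for a chart
  density `g > 0` (a PARAMETER: the Haar measure of `G` in the exponential chart is `c·g·Lebesgue` on small balls).
Part 2 (`…RepresentationG`) assembles the representation of the conditioned box state.  No sorry; no definition; standard axioms.
NOT a claim about the Yang–Mills mass gap (rung-level support, RECORD label).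
-/

set_option autoImplicit false
set_option synthInstance.maxSize 4096

noncomputable section

open MeasureTheory ProbabilityTheory Finset Metric
open scoped ENNReal Matrix.Norms.Frobenius
open Literature.Probability.LatticeModels (Site)
open Literature.MathematicalPhysics.QuantumLattice
open Literature.MathematicalPhysics.QuantumFieldTheory
open Literature.MathematicalPhysics.QuantumFieldTheory.LatticeMaxwell
open Literature.MathematicalPhysics.QuantumFieldTheory.AxialGauge
open Literature.MathematicalPhysics.QuantumFieldTheory.GaussianToolkit

namespace Summit.QuantumFields.YangMills.Theorems.ColdBoxAllGroups

open Summit.QuantumFields.YangMills.Theorems.WeakCouplingRates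
open Summit.QuantumFields.YangMills.Theorems.FreeEnergyLogCoefficient

variable {H : ℕ}

/-! ## §1 The Gaussian side with `D` colours -/

/-- **Change of variables with a constant Jacobian**: for `β > 0` there is `a ∈ (0, ∞)` such that
`∫⁻ F(w) dw = a · ∫⁻ F(unscaleTE H D β t) dt` for every measurable `F : (ColdFreeIdx H → ℝ^D) → [0,∞]` (the image of Lebesgue measure under
the linear equivalence `scaleEquivE` is a Haar measure, hence a multiple of Lebesgue measure; the value of `a` cancels later). -/
theorem exists_lintegral_eq_mul_lintegral_unscaleTE (D : ℕ) {β : ℝ} (hβ : 0 < β) :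
    ∃ a : ℝ≥0∞, a ≠ 0 ∧ a ≠ ∞ ∧ ∀ F : (ColdFreeIdx H → EuclideanSpace ℝ (Fin D)) → ℝ≥0∞, Measurable F →
      ∫⁻ w, F w ∂(volume : Measure (ColdFreeIdx H → EuclideanSpace ℝ (Fin D))) =
        a * ∫⁻ t, F (unscaleTE H D β t) ∂(volume : Measure (TSpaceD H D)) := by
  set e := scaleEquivE H D hβ with he
  set μ' : Measure (TSpaceD H D) := (volume : Measure (ColdFreeIdx H → EuclideanSpace ℝ (Fin D))).map e with hμ'
  haveI : μ'.IsAddHaarMeasure := by rw [hμ']; infer_instance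
  have hprop : μ' = Measure.addHaarScalarFactor μ' (volume : Measure (TSpaceD H D)) • (volume : Measure (TSpaceD H D)) :=
    Measure.isAddLeftInvariant_eq_smul μ' volume
  have hpos : 0 < Measure.addHaarScalarFactor μ' (volume : Measure (TSpaceD H D)) :=
    Measure.addHaarScalarFactor_pos_of_isAddHaarMeasure μ' volume
  refine ⟨Measure.addHaarScalarFactor μ' (volume : Measure (TSpaceD H D)), by exact_mod_cast hpos.ne', ENNReal.coe_ne_top,
    fun F hF => ?_⟩
  have hme : Measurable e := e.continuous.measurable
  calc ∫⁻ w, F w ∂(volume : Measure (ColdFreeIdx H → EuclideanSpace ℝ (Fin D)))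
      = ∫⁻ w, (F ∘ unscaleTE H D β) (e w) ∂(volume : Measure (ColdFreeIdx H → EuclideanSpace ℝ (Fin D))) := by
        refine lintegral_congr fun w => ?_
        simp only [Function.comp_apply, he, scaleEquivE_apply, unscaleTE_scaleTE D hβ]
    _ = ∫⁻ t, (F ∘ unscaleTE H D β) t ∂μ' := by
        rw [hμ', lintegral_map (hF.comp (measurable_unscaleTE D β)) hme]
    _ = _ := by
        conv_lhs => rw [hprop]
        rw [lintegral_smul_measure]
        rfl

/-- Half the sum of the `D` Dirichlet forms is the sum of the quadratic surrogates over the plaquettes touching the box. -/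
theorem sum_formM_div_two_eq_sum_qObsD (D : ℕ) (t : TSpaceD H D) :
    ∑ i, formM (fun e => e ∉ dirFreeEdges H) dirCorner (2 * H + 3) 0 (WithLp.ofLp (t i)) / 2 =
      ∑ q ∈ plaquettesTouching (boxEdges 4 (2 * H + 1)), qObsD H D (q.1, q.2.1.1, q.2.1.2) t := by
  simp only [formM_dir_eq_sum_touching, qObsD, ← dirCirc_apply, Finset.sum_div, Finset.mul_sum]
  rw [Finset.sum_comm]
  refine Finset.sum_congr rfl fun q _ => Finset.sum_congr rfl fun i _ => ?_
  ring

/-- The product of the `D` one-colour Gaussian weights is `exp(−Σ_{p touching Λ} qObsD p t)`. -/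
theorem prod_gaussWeight_eq_D (D : ℕ) (t : TSpaceD H D) :
    ∏ i, gaussWeight (Qmat (fun e => e ∉ dirFreeEdges H) dirCorner (2 * H + 3)) (t i) =
      ENNReal.ofReal (Real.exp (-(∑ q ∈ plaquettesTouching (boxEdges 4 (2 * H + 1)), qObsD H D (q.1, q.2.1.1, q.2.1.2) t))) := by
  rw [Finset.prod_congr rfl fun i _ => gaussWeight_dirQmat (t i),
    ← ENNReal.ofReal_prod_of_nonneg (fun i _ => (Real.exp_pos _).le), ← Real.exp_sum]
  congr 2
  rw [← sum_formM_div_two_eq_sum_qObsD, ← Finset.sum_neg_distrib]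
  refine Finset.sum_congr rfl fun i _ => ?_
  ring

/-- **Gaussian-weighted Lebesgue integrals on `TSpaceD` are `Z^D ·` expectations under `gaussD H D`**: for measurable `F ≥ 0`,
`∫⁻ F(t) · Π_i gaussWeight_{Q_D}(t i) dt = Z_D^D · ∫⁻ F d(gaussD H D)`. -/
theorem lintegral_mul_prod_gaussWeight_eq_D (D : ℕ) (F : TSpaceD H D → ℝ≥0∞) (hF : Measurable F) :
    ∫⁻ t, F t * ∏ i, gaussWeight (Qmat (fun e => e ∉ dirFreeEdges H) dirCorner (2 * H + 3)) (t i)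
        ∂(volume : Measure (TSpaceD H D)) =
      gaussZ (Qmat (fun e => e ∉ dirFreeEdges H) dirCorner (2 * H + 3)) ^ D * ∫⁻ t, F t ∂(gaussD H D) := by
  obtain ⟨-, hZ0, hZtop⟩ := boxDirichlet_eq_withDensity H
  set Q := Qmat (fun e => e ∉ dirFreeEdges H) dirCorner (2 * H + 3) with hQ
  set Z := gaussZ Q with hZ
  set f : EuclideanSpace ℝ (DirFree H) → ℝ≥0∞ := Z⁻¹ • gaussWeight Q with hf
  have hfm : Measurable f := (measurable_gaussWeight Q).const_smul _
  haveI : SigmaFinite ((volume : Measure (EuclideanSpace ℝ (DirFree H))).withDensity f) := by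
    rw [hf, ← boxDirichlet_eq_withDensity_smul]; infer_instance
  have hpi : gaussD H D = (volume : Measure (TSpaceD H D)).withDensity fun t => ∏ i, f (t i) := by
    rw [gaussD]
    simp_rw [boxDirichlet_eq_withDensity_smul, ← hQ, ← hZ]
    rw [pi_withDensity _ _ (fun _ => hfm), volume_pi]
  have hprod : ∀ t : TSpaceD H D, ∏ i, f (t i) = (Z⁻¹) ^ D * ∏ i, gaussWeight Q (t i) := fun t => by
    simp only [hf, Pi.smul_apply, smul_eq_mul, Finset.prod_mul_distrib, Finset.prod_const, Finset.card_univ,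
      Fintype.card_fin]
  have hm : Measurable (fun t : TSpaceD H D => ∏ i, f (t i)) :=
    Finset.measurable_prod _ fun i _ => hfm.comp (measurable_pi_apply i)
  rw [hpi, lintegral_withDensity_eq_lintegral_mul _ hm hF]
  have hmeas : Measurable fun t : TSpaceD H D => F t * ∏ i, gaussWeight Q (t i) :=
    hF.mul (Finset.measurable_prod _ fun i _ => (measurable_gaussWeight Q).comp (measurable_pi_apply i))
  have hZD : Z ^ D * (Z⁻¹) ^ D = 1 := by
    rw [← mul_pow, ENNReal.mul_inv_cancel hZ0 hZtop, one_pow]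
  calc ∫⁻ t, F t * ∏ i, gaussWeight Q (t i) ∂(volume : Measure (TSpaceD H D))
      = ∫⁻ t, Z ^ D * ((Z⁻¹) ^ D * (F t * ∏ i, gaussWeight Q (t i))) ∂(volume : Measure (TSpaceD H D)) :=
        lintegral_congr fun t => by rw [← mul_assoc, hZD, one_mul]
    _ = Z ^ D * ∫⁻ t, (Z⁻¹) ^ D * (F t * ∏ i, gaussWeight Q (t i)) ∂(volume : Measure (TSpaceD H D)) :=
        lintegral_const_mul _ (measurable_const.mul hmeas)
    _ = Z ^ D * ∫⁻ t, ((fun t : TSpaceD H D => ∏ i, f (t i)) * F) t ∂(volume : Measure (TSpaceD H D)) := by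
        congr 1
        exact lintegral_congr fun t => by simp only [Pi.mul_apply, hprod]; ring

/-! ## §2 The density identity -/

section Density

variable {N : ℕ} {G : Type} [Group G] (ρ : G →* Matrix (Fin N) (Fin N) ℂ)

/-- The boundary Wilson action of the cold box is the sum of the plaquette costs over the plaquettes touching it. -/
theorem wilsonBoundaryAction_eq_sum_plaqCostAt_G (U : LGConfig 4 G) :
    wilsonBoundaryAction ρ (boxEdges 4 (2 * H + 1)) U =
      ∑ q ∈ plaquettesTouching (boxEdges 4 (2 * H + 1)), plaqCostAt ρ q.1 q.2.1.1 q.2.1.2 U := by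
  simp [wilsonBoundaryAction, plaqCostAt]

/-- The real form of the density identity: for a density `g > 0` at the unscaled links,
`e^{−βS_Λ(cfgTE t)} · Π_e g(a_e) = e^{−Σ_q qObsD q t} · e^{tiltWE t}`. -/
theorem boltzmann_mul_density_eq_real (g : EuclideanSpace ℝ (Fin (dimE ρ)) → ℝ) (β : ℝ) (t : TSpaceD H (dimE ρ))
    (hg : ∀ e : ColdFreeIdx H, 0 < g (unscaleTE H (dimE ρ) β t e)) :
    Real.exp (-β * wilsonBoundaryAction ρ (boxEdges 4 (2 * H + 1)) (cfgTE ρ H β t)) *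
        ∏ e : ColdFreeIdx H, g (unscaleTE H (dimE ρ) β t e) =
      Real.exp (-(∑ q ∈ plaquettesTouching (boxEdges 4 (2 * H + 1)), qObsD H (dimE ρ) (q.1, q.2.1.1, q.2.1.2) t)) *
        Real.exp (tiltWE ρ H g β t) := by
  have hJ : Real.exp (∑ e : ColdFreeIdx H, Real.log (g (unscaleTE H (dimE ρ) β t e))) =
      ∏ e : ColdFreeIdx H, g (unscaleTE H (dimE ρ) β t e) := by
    rw [Real.exp_sum]
    exact Finset.prod_congr rfl fun e _ => Real.exp_log (hg e)
  have hexp : Real.exp (-(∑ q ∈ plaquettesTouching (boxEdges 4 (2 * H + 1)), qObsD H (dimE ρ) (q.1, q.2.1.1, q.2.1.2) t)) *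
      Real.exp (∑ q ∈ plaquettesTouching (boxEdges 4 (2 * H + 1)),
        (qObsD H (dimE ρ) (q.1, q.2.1.1, q.2.1.2) t - β * plaqCostAt ρ q.1 q.2.1.1 q.2.1.2 (cfgTE ρ H β t))) =
      Real.exp (-β * ∑ q ∈ plaquettesTouching (boxEdges 4 (2 * H + 1)), plaqCostAt ρ q.1 q.2.1.1 q.2.1.2 (cfgTE ρ H β t)) := by
    rw [← Real.exp_add]
    congr 1
    rw [neg_mul, Finset.mul_sum, Finset.sum_sub_distrib]
    ring
  rw [wilsonBoundaryAction_eq_sum_plaqCostAt_G, tiltWE, Real.exp_add, hJ, ← hexp]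
  ring

/-- **The density identity**: `e^{−βS_Λ(cfgTE t)} · Π_e g(a_e) = Π_i gaussWeight_{Q_D}(t i) · e^{tiltWE t}` for a density `g > 0` at the
unscaled links `a_e = unscaleTE t e`. -/
theorem boltzmann_mul_density_eq (g : EuclideanSpace ℝ (Fin (dimE ρ)) → ℝ) (β : ℝ) (t : TSpaceD H (dimE ρ))
    (hg : ∀ e : ColdFreeIdx H, 0 < g (unscaleTE H (dimE ρ) β t e)) :
    ENNReal.ofReal (Real.exp (-β * wilsonBoundaryAction ρ (boxEdges 4 (2 * H + 1)) (cfgTE ρ H β t))) *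
        ∏ e : ColdFreeIdx H, ENNReal.ofReal (g (unscaleTE H (dimE ρ) β t e)) =
      (∏ i, gaussWeight (Qmat (fun e => e ∉ dirFreeEdges H) dirCorner (2 * H + 3)) (t i)) *
        ENNReal.ofReal (Real.exp (tiltWE ρ H g β t)) := by
  rw [← ENNReal.ofReal_prod_of_nonneg (fun e _ => (hg e).le), ← ENNReal.ofReal_mul (Real.exp_pos _).le,
    boltzmann_mul_density_eq_real ρ g β t hg, prod_gaussWeight_eq_D, ← ENNReal.ofReal_mul (by positivity)]

end Density

end Summit.QuantumFields.YangMills.Theorems.ColdBoxAllGroups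

end
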